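import Summits.ABC.IUTFork.Joshi.ATS4MainBoundsGenuineTheta
import Summits.ABC.IUTFork.Joshi.ATS4DescentToFirstMainBound
import HarnessLib

/-!
# [J-IV] (arXiv:2403.10430v2) Lemma 6.4.2 (2) on E-t31's §6.8–§6.11 carrier — `LocusVolumeDatum.Lem642₂` DERIVED at every carrier glued
# to a genuine theta tower (R-J census row Y-21x ⟨`Lem642₂`⟩; proof-only, 0 defs)

Proof-only companion of the abc-iut cell, sub-cell R-J «JOSHI Y-DISCHARGE CENSUS» (rung LADDER-ABC:A2.RESCUE.J; D-0079; table of record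
`HOME/plan/E/R-J/Y-CENSUS.tsv`, row Y-21x = the [J-IV] extras of the E5 spine), seat abc-iut-E-t10 (gen 4; CLAIM 15:55:14Z, E-plan
ruling 15:40:45Z). Parents BUILT, every input BY NAME, nothing restated: E-t31's carrier `LocusVolumeDatum` with the READING PREDICATE
`Lem642₂` (`Joshi/ATS4LocusUpperBounds.lean`, p430311: «(1 + 4/ℓ)·log(d_{L′}) ≤ (1 + 4/ℓ)(log(d_{L_tpd}) + log(f_{L_tpd})) + 4·log(ℓ) + 74»,
[J-IV] Lemma 6.4.2 (2), p.60 l.6–21, blue constants), E-t31's glue `MainBoundGlue` with `MainBoundGlue.lem642_iff : d.Lem642₂ ↔ M.Lem642b`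
(`Joshi/ATS4DescentToFirstMainBound.lean`, p433649), E-t30's carrier `MainBoundDatum` with `Lem642b`, `lem642a_of`, `lem642b_of_lem642a`
(`Joshi/ATS4MainBounds.lean`) and its genuine theta-tower discharge `MainBoundDatum.thetaTower_lem642b` (`Joshi/ATS4MainBoundsGenuineTheta.lean`,
p440894: Lemma 6.4.2 (2) PROVED — in fact with Mochizuki's [IUTchIV] Step (ii) constants `2·log ℓ + 21 ≤ 4·log ℓ + 74` — for the tower
`F_tpd ⊆ F ⊆ K`, `F` a theta field of `λ ∈ U_X`, `K ⊆ F(E_F[ℓ])` Galois over `F`, `ℓ ≥ 7`).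

WHAT IS HERE (theorems only; standard axioms; no `sorry`, instance, notation, `def` or new `Prop`):
* `LocusVolumeDatum.lem642₂_of_glue` — `Lem642₂` at any carrier glued to a Thm-6.1.1 datum satisfying `Lem642b` (one rewrite);
* `LocusVolumeDatum.lem642₂_of_glue_inputs` — … or satisfying Joshi's three printed §6.4 inputs `Lem641 ∧ WildBoundLp ∧ DegLpLBound`
  (T-30's `lem642a_of` / `lem642b_of_lem642a`, the route print takes, p.59 l.37 – p.60 l.21);
* **`LocusVolumeDatum.lem642₂_of_thetaTowerGlue`** — **`Lem642₂` HOLDS at EVERY carrier glued to `MainBoundDatum.ofGenuine` on the genuine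
  theta tower** (`thetaTower_lem642b` through the glue): the R-J word for Y-21x ⟨`Lem642₂`⟩ is DECIDED-DERIVED at the genuine carrier; FACT
  rows used: none (tree theorems only — Dedekind different bounds for Galois towers of Mathlib number fields, p439256/p440894).
HONEST SCOPE: the bare `LocusVolumeDatum` slot `log(d_{L′})` is a free real — `Lem642₂` is not derivable on the unglued carrier (nor refutable:
it holds at the toy datum p430744); what is decided is its status AT GENUINE DATA through the glue. No side taken on [IUTchIII] Cor. 3.12 /
[IUTchIV] Thm. 1.10, on Joshi's claims or on Mochizuki's report on them; typed ≠ proved ≠ endorsed; NOT an abc claim.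
bears_on: LADDER-ABC:A2.RESCUE.J.
-/

noncomputable section

namespace Summit.ABC.IUTFork.Joshi.ATS4

open Literature.NumberTheory.DiophantineGeometry Literature.NumberTheory.DiophantineGeometry.GenEll
open Literature.IUT.LogVolume Literature.IUT.LogVolume.Cor22
open NumberField

/-- **Y-21x ⟨`Lem642₂`⟩ through the glue**: a carrier glued to a Thm-6.1.1 datum satisfying Lemma 6.4.2 (2) satisfies `Lem642₂` (E-t31's
`MainBoundGlue.lem642_iff`, one direction, named). [claim: Joshi2024ATS4, status: disputed] -/
theorem LocusVolumeDatum.lem642₂_of_glue {M : MainBoundDatum} {d : LocusVolumeDatum} (G : MainBoundGlue M d) (h : M.Lem642b) :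
    d.Lem642₂ :=
  G.lem642_iff.2 h

/-- … or satisfying Joshi's three printed §6.4 inputs (Lem. 6.4.1, Thm. 4.6.1 (5) for `L′/L`, `[L′ : L] ≤ ℓ⁴`), the route of print
(p.59 l.37 – p.60 l.21; T-30's `lem642a_of`, `lem642b_of_lem642a`). [claim: Joshi2024ATS4, status: disputed] -/
theorem LocusVolumeDatum.lem642₂_of_glue_inputs {M : MainBoundDatum} {d : LocusVolumeDatum} (G : MainBoundGlue M d)
    (m₁ : M.Lem641) (m₂ : M.WildBoundLp) (m₃ : M.DegLpLBound) : d.Lem642₂ :=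
  G.lem642_iff.2 (M.lem642b_of_lem642a (M.lem642a_of m₁ m₂ m₃))

section ThetaTower

variable (Lmod : Type*) [Field Lmod] [NumberField Lmod]
variable {P : NFPoint} {F : Type} [Field F] [NumberField F] [Algebra P.F F]
  {K : Type} [Field K] [NumberField K] [Algebra F K] [Algebra P.F K] [IsScalarTower P.F F K]
  (ψ : K →ₐ[F] AlgebraicClosure F)
variable {ℓ : ℕ} (hℓ : ℓ.Prime) (h5 : 5 ≤ ℓ)
variable (hq : 0 < (TateDivisorDatum.ofNFPointOver P {2, ℓ} F).logq)

/-- **Y-21x ⟨`Lem642₂`⟩ DECIDED-DERIVED at the genuine theta tower.** For `λ ∈ U_X` (`P.InU`), a theta field `F` of `λ`, `K ⊇ F` Galois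
inside the `ℓ`-division field of the theta curve (`ker ρ̄_{E_F,ℓ} ≤ Gal(F̄/ψK)`), `ℓ ≥ 7` prime, and ANY carrier `dd` glued to E-t30's
genuine Thm-6.1.1 datum `MainBoundDatum.ofGenuine L_mod … (𝔮_{F_tpd}, 𝔮_F, 𝔮_K)`: `dd.Lem642₂` HOLDS — E-t30's `thetaTower_lem642b`
(p440894) carried through E-t31's glue. FACT rows used: none. [claim: Joshi2024ATS4, status: disputed] -/
theorem LocusVolumeDatum.lem642₂_of_thetaTowerGlue (hU : P.InU) (hF : IsThetaField P F) [IsGalois F K] (h7 : 7 ≤ ℓ)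
    (hK : letI := thetaCurve_isElliptic hU F
      ((thetaCurve P F).galoisRepTorsion (ℓ : ℤ)).ker ≤ ψ.fieldRange.fixingSubgroup)
    {dd : LocusVolumeDatum}
    (G : MainBoundGlue (MainBoundDatum.ofGenuine Lmod hℓ h5 (TateDivisorDatum.ofNFPoint P {2, ℓ})
      (TateDivisorDatum.ofNFPointOver P {2, ℓ} F) (TateDivisorDatum.ofNFPointOver P {2, ℓ} K) hq) dd) : dd.Lem642₂ :=
  G.lem642_iff.2 (MainBoundDatum.thetaTower_lem642b Lmod ψ hℓ h5 hq hU hF h7 hK)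

end ThetaTower

end Summit.ABC.IUTFork.Joshi.ATS4

end
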